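import Summits.CriticalPhenomena.PercolationContinuityZ3.Theorems.PercNearOneGluingNoHeavyLowerTailSahiE3ThreePrimeCases
import Summits.CriticalPhenomena.PercolationContinuityZ3.Theorems.PercNearOneGluingNoHeavyLowerTailSahiE3OrPairSlot
import Summits.CriticalPhenomena.PercolationContinuityZ3.Theorems.PercNearOneGluingNoHeavyLowerTailSahiE3Hit3Slot
import Summits.CriticalPhenomena.PercolationContinuityZ3.Theorems.PercNearOneGluingNoHeavyLowerTailSahiE3FilterRestriction
import HarnessLib
import HarnessLib.Audit

/-!
# `NoHeavyLowerTail` (crux stmt-CriticalPhenomena-4575), Sahi programme P4 (Holley / monotone coupling):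
# Sahi's `C₃` under every FKG measure for EVERY slot generated by three join-primes

Support file (cell `prim-l12`, seat P4, generation 10; `--supports stmt-CriticalPhenomena-4575`).  No named facts, no sorries; standard
axioms; def-free.

THEOREM (`latticeE3_nonneg_of_threePrimes`).  `L` a finite distributive lattice, `μ ≥ 0` log-supermodular, `A, B` up-sets, `j₁, j₂, j₃`
join-prime, and `U'` ANY up-set of patterns `Fin 3 → Bool`; then `0 ≤ latticeE3 μ U A B` for the preimage slot
`U = {x | (j₁ ≤ x, j₂ ≤ x, j₃ ≤ x) ∈ U'}` — i.e. for every slot in the sublattice of up-sets generated by `↑j₁, ↑j₂, ↑j₃`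
(all unions of the principal up-sets `↑(⊔_{i∈I} jᵢ)`).  PROOF: the twenty up-sets of `2³` (`upset_cases`) fall into the classes settled in
the tree: `∅` (the functional vanishes), principal slots [Sahi 2008, Thm 2; Blinovsky] (`Literature…latticeE3_nonneg_of_principal`: `{⊤}`,
`↑(xy)`, `↑x`, everything), two join-primes (`…SahiE3TwoPrimeSlot`, generation 6), `↑(f⊔j₁) ∪ ↑(f⊔j₂)` (`…SahiE3FilterRestriction`, gen 8),
majority (`…SahiE3MajSlot`, gen 9), `↑j ∪ ↑(j'⊔j″)` (`…SahiE3OrPairSlot`, gen 10) and the hitting slot `↑j₁ ∪ ↑j₂ ∪ ↑j₃` (`…SahiE3Hit3Slot`,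
gen 10).  On the programme's `k = 5` residual atlas this covers the 762 of 1,067 tri-saturated orbits having a slot that is a 3-junta.
-/

namespace Summit.CriticalPhenomena.PercolationContinuityZ3.Theorems.SahiE3ThreePrimes

open Finset Literature.Probability.LatticeModels
open scoped BigOperators

variable {α : Type*} [DistribLattice α] [Fintype α] [DecidableEq α] [DecidableLE α]

omit [DecidableEq α] in
/-- The preimage of the pattern up-set #1 under `x ↦ (jᵢ ≤ x)_i` as a lattice slot. [this work] -/
theorem preimage_1 (j₁ j₂ j₃ : α) :
    (univ.filter fun x : α => (fun i => decide (![j₁, j₂, j₃] i ≤ x)) ∈ ({![true, true,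
        true]} : Finset (Fin 3 → Bool))) =
      principalUp (j₁ ⊔ j₂ ⊔ j₃) := by
  ext x
  by_cases ha : j₁ ≤ x <;> by_cases hb : j₂ ≤ x <;> by_cases hc : j₃ ≤ x <;>
    simp [ha, hb, hc, mem_principalUp, funext_iff, Fin.forall_fin_succ]

omit [DecidableEq α] in
/-- The preimage of the pattern up-set #2 under `x ↦ (jᵢ ≤ x)_i` as a lattice slot. [this work] -/
theorem preimage_2 (j₁ j₂ j₃ : α) :
    (univ.filter fun x : α => (fun i => decide (![j₁, j₂, j₃] i ≤ x)) ∈ ({![true, true, false], ![true, true,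
        true]} : Finset (Fin 3 → Bool))) =
      principalUp (j₁ ⊔ j₂) := by
  ext x
  by_cases ha : j₁ ≤ x <;> by_cases hb : j₂ ≤ x <;> by_cases hc : j₃ ≤ x <;>
    simp [ha, hb, hc, mem_principalUp, funext_iff, Fin.forall_fin_succ]

omit [DecidableEq α] in
/-- The preimage of the pattern up-set #3 under `x ↦ (jᵢ ≤ x)_i` as a lattice slot. [this work] -/
theorem preimage_3 (j₁ j₂ j₃ : α) :
    (univ.filter fun x : α => (fun i => decide (![j₁, j₂, j₃] i ≤ x)) ∈ ({![true, false, true], ![true, true,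
        true]} : Finset (Fin 3 → Bool))) =
      principalUp (j₁ ⊔ j₃) := by
  ext x
  by_cases ha : j₁ ≤ x <;> by_cases hb : j₂ ≤ x <;> by_cases hc : j₃ ≤ x <;>
    simp [ha, hb, hc, mem_principalUp, funext_iff, Fin.forall_fin_succ]

omit [DecidableEq α] in
/-- The preimage of the pattern up-set #4 under `x ↦ (jᵢ ≤ x)_i` as a lattice slot. [this work] -/
theorem preimage_4 (j₁ j₂ j₃ : α) :
    (univ.filter fun x : α => (fun i => decide (![j₁, j₂, j₃] i ≤ x)) ∈ ({![false, true, true], ![true, true,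
        true]} : Finset (Fin 3 → Bool))) =
      principalUp (j₂ ⊔ j₃) := by
  ext x
  by_cases ha : j₁ ≤ x <;> by_cases hb : j₂ ≤ x <;> by_cases hc : j₃ ≤ x <;>
    simp [ha, hb, hc, mem_principalUp, funext_iff, Fin.forall_fin_succ]

/-- The preimage of the pattern up-set #5 under `x ↦ (jᵢ ≤ x)_i` as a lattice slot. [this work] -/
theorem preimage_5 (j₁ j₂ j₃ : α) :
    (univ.filter fun x : α => (fun i => decide (![j₁, j₂, j₃] i ≤ x)) ∈ ({![true, true, false], ![true, false, true],
        ![true, true, true]} : Finset (Fin 3 → Bool))) =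
      principalUp (j₁ ⊔ j₂) ∪ principalUp (j₁ ⊔ j₃) := by
  ext x
  by_cases ha : j₁ ≤ x <;> by_cases hb : j₂ ≤ x <;> by_cases hc : j₃ ≤ x <;>
    simp [ha, hb, hc, mem_principalUp, funext_iff, Fin.forall_fin_succ]

/-- The preimage of the pattern up-set #6 under `x ↦ (jᵢ ≤ x)_i` as a lattice slot. [this work] -/
theorem preimage_6 (j₁ j₂ j₃ : α) :
    (univ.filter fun x : α => (fun i => decide (![j₁, j₂, j₃] i ≤ x)) ∈ ({![true, true, false], ![false, true, true],
        ![true, true, true]} : Finset (Fin 3 → Bool))) =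
      principalUp (j₁ ⊔ j₂) ∪ principalUp (j₂ ⊔ j₃) := by
  ext x
  by_cases ha : j₁ ≤ x <;> by_cases hb : j₂ ≤ x <;> by_cases hc : j₃ ≤ x <;>
    simp [ha, hb, hc, mem_principalUp, funext_iff, Fin.forall_fin_succ]

/-- The preimage of the pattern up-set #7 under `x ↦ (jᵢ ≤ x)_i` as a lattice slot. [this work] -/
theorem preimage_7 (j₁ j₂ j₃ : α) :
    (univ.filter fun x : α => (fun i => decide (![j₁, j₂, j₃] i ≤ x)) ∈ ({![true, false, true], ![false, true, true],
        ![true, true, true]} : Finset (Fin 3 → Bool))) =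
      principalUp (j₁ ⊔ j₃) ∪ principalUp (j₂ ⊔ j₃) := by
  ext x
  by_cases ha : j₁ ≤ x <;> by_cases hb : j₂ ≤ x <;> by_cases hc : j₃ ≤ x <;>
    simp [ha, hb, hc, mem_principalUp, funext_iff, Fin.forall_fin_succ]

omit [DecidableEq α] in
/-- The preimage of the pattern up-set #8 under `x ↦ (jᵢ ≤ x)_i` as a lattice slot. [this work] -/
theorem preimage_8 (j₁ j₂ j₃ : α) :
    (univ.filter fun x : α => (fun i => decide (![j₁, j₂, j₃] i ≤ x)) ∈ ({![true, false, false], ![true, true,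
        false], ![true, false, true], ![true, true, true]} : Finset (Fin 3 → Bool))) =
      principalUp j₁ := by
  ext x
  by_cases ha : j₁ ≤ x <;> by_cases hb : j₂ ≤ x <;> by_cases hc : j₃ ≤ x <;>
    simp [ha, hb, hc, mem_principalUp, funext_iff, Fin.forall_fin_succ]

omit [DecidableEq α] in
/-- The preimage of the pattern up-set #9 under `x ↦ (jᵢ ≤ x)_i` as a lattice slot. [this work] -/
theorem preimage_9 (j₁ j₂ j₃ : α) :
    (univ.filter fun x : α => (fun i => decide (![j₁, j₂, j₃] i ≤ x)) ∈ ({![false, true, false], ![true, true,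
        false], ![false, true, true], ![true, true, true]} : Finset (Fin 3 → Bool))) =
      principalUp j₂ := by
  ext x
  by_cases ha : j₁ ≤ x <;> by_cases hb : j₂ ≤ x <;> by_cases hc : j₃ ≤ x <;>
    simp [ha, hb, hc, mem_principalUp, funext_iff, Fin.forall_fin_succ]

omit [DecidableEq α] in
/-- The preimage of the pattern up-set #10 under `x ↦ (jᵢ ≤ x)_i` as a lattice slot. [this work] -/
theorem preimage_10 (j₁ j₂ j₃ : α) :
    (univ.filter fun x : α => (fun i => decide (![j₁, j₂, j₃] i ≤ x)) ∈ ({![false, false, true], ![true, false,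
        true], ![false, true, true], ![true, true, true]} : Finset (Fin 3 → Bool))) =
      principalUp j₃ := by
  ext x
  by_cases ha : j₁ ≤ x <;> by_cases hb : j₂ ≤ x <;> by_cases hc : j₃ ≤ x <;>
    simp [ha, hb, hc, mem_principalUp, funext_iff, Fin.forall_fin_succ]

/-- The preimage of the pattern up-set #11 under `x ↦ (jᵢ ≤ x)_i` as a lattice slot. [this work] -/
theorem preimage_11 (j₁ j₂ j₃ : α) :
    (univ.filter fun x : α => (fun i => decide (![j₁, j₂, j₃] i ≤ x)) ∈ ({![true, true, false], ![true, false, true],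
        ![false, true, true], ![true, true, true]} : Finset (Fin 3 → Bool))) =
      principalUp (j₁ ⊔ j₂) ∪ principalUp (j₁ ⊔ j₃) ∪ principalUp (j₂ ⊔ j₃) := by
  ext x
  by_cases ha : j₁ ≤ x <;> by_cases hb : j₂ ≤ x <;> by_cases hc : j₃ ≤ x <;>
    simp [ha, hb, hc, mem_principalUp, funext_iff, Fin.forall_fin_succ]

/-- The preimage of the pattern up-set #12 under `x ↦ (jᵢ ≤ x)_i` as a lattice slot. [this work] -/
theorem preimage_12 (j₁ j₂ j₃ : α) :
    (univ.filter fun x : α => (fun i => decide (![j₁, j₂, j₃] i ≤ x)) ∈ ({![true, false, false], ![true, true,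
        false], ![true, false, true], ![false, true, true], ![true, true, true]} : Finset (Fin 3 → Bool))) =
      principalUp j₁ ∪ principalUp (j₂ ⊔ j₃) := by
  ext x
  by_cases ha : j₁ ≤ x <;> by_cases hb : j₂ ≤ x <;> by_cases hc : j₃ ≤ x <;>
    simp [ha, hb, hc, mem_principalUp, funext_iff, Fin.forall_fin_succ]

/-- The preimage of the pattern up-set #13 under `x ↦ (jᵢ ≤ x)_i` as a lattice slot. [this work] -/
theorem preimage_13 (j₁ j₂ j₃ : α) :
    (univ.filter fun x : α => (fun i => decide (![j₁, j₂, j₃] i ≤ x)) ∈ ({![false, true, false], ![true, true,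
        false], ![true, false, true], ![false, true, true], ![true, true, true]} : Finset (Fin 3 → Bool))) =
      principalUp j₂ ∪ principalUp (j₁ ⊔ j₃) := by
  ext x
  by_cases ha : j₁ ≤ x <;> by_cases hb : j₂ ≤ x <;> by_cases hc : j₃ ≤ x <;>
    simp [ha, hb, hc, mem_principalUp, funext_iff, Fin.forall_fin_succ]

/-- The preimage of the pattern up-set #14 under `x ↦ (jᵢ ≤ x)_i` as a lattice slot. [this work] -/
theorem preimage_14 (j₁ j₂ j₃ : α) :
    (univ.filter fun x : α => (fun i => decide (![j₁, j₂, j₃] i ≤ x)) ∈ ({![false, false, true], ![true, true,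
        false], ![true, false, true], ![false, true, true], ![true, true, true]} : Finset (Fin 3 → Bool))) =
      principalUp j₃ ∪ principalUp (j₁ ⊔ j₂) := by
  ext x
  by_cases ha : j₁ ≤ x <;> by_cases hb : j₂ ≤ x <;> by_cases hc : j₃ ≤ x <;>
    simp [ha, hb, hc, mem_principalUp, funext_iff, Fin.forall_fin_succ]

/-- The preimage of the pattern up-set #15 under `x ↦ (jᵢ ≤ x)_i` as a lattice slot. [this work] -/
theorem preimage_15 (j₁ j₂ j₃ : α) :
    (univ.filter fun x : α => (fun i => decide (![j₁, j₂, j₃] i ≤ x)) ∈ ({![true, false, false], ![false, true,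
        false], ![true, true, false], ![true, false, true], ![false, true, true], ![true, true,
        true]} : Finset (Fin 3 → Bool))) =
      principalUp j₁ ∪ principalUp j₂ := by
  ext x
  by_cases ha : j₁ ≤ x <;> by_cases hb : j₂ ≤ x <;> by_cases hc : j₃ ≤ x <;>
    simp [ha, hb, hc, mem_principalUp, funext_iff, Fin.forall_fin_succ]

/-- The preimage of the pattern up-set #16 under `x ↦ (jᵢ ≤ x)_i` as a lattice slot. [this work] -/
theorem preimage_16 (j₁ j₂ j₃ : α) :
    (univ.filter fun x : α => (fun i => decide (![j₁, j₂, j₃] i ≤ x)) ∈ ({![true, false, false], ![false, false,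
        true], ![true, true, false], ![true, false, true], ![false, true, true], ![true, true,
        true]} : Finset (Fin 3 → Bool))) =
      principalUp j₁ ∪ principalUp j₃ := by
  ext x
  by_cases ha : j₁ ≤ x <;> by_cases hb : j₂ ≤ x <;> by_cases hc : j₃ ≤ x <;>
    simp [ha, hb, hc, mem_principalUp, funext_iff, Fin.forall_fin_succ]

/-- The preimage of the pattern up-set #17 under `x ↦ (jᵢ ≤ x)_i` as a lattice slot. [this work] -/
theorem preimage_17 (j₁ j₂ j₃ : α) :
    (univ.filter fun x : α => (fun i => decide (![j₁, j₂, j₃] i ≤ x)) ∈ ({![false, true, false], ![false, false,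
        true], ![true, true, false], ![true, false, true], ![false, true, true], ![true, true,
        true]} : Finset (Fin 3 → Bool))) =
      principalUp j₂ ∪ principalUp j₃ := by
  ext x
  by_cases ha : j₁ ≤ x <;> by_cases hb : j₂ ≤ x <;> by_cases hc : j₃ ≤ x <;>
    simp [ha, hb, hc, mem_principalUp, funext_iff, Fin.forall_fin_succ]

/-- The preimage of the pattern up-set #18 under `x ↦ (jᵢ ≤ x)_i` as a lattice slot. [this work] -/
theorem preimage_18 (j₁ j₂ j₃ : α) :
    (univ.filter fun x : α => (fun i => decide (![j₁, j₂, j₃] i ≤ x)) ∈ ({![true, false, false], ![false, true,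
        false], ![false, false, true], ![true, true, false], ![true, false, true], ![false, true, true], ![true,
        true, true]} : Finset (Fin 3 → Bool))) =
      principalUp j₁ ∪ principalUp j₂ ∪ principalUp j₃ := by
  ext x
  by_cases ha : j₁ ≤ x <;> by_cases hb : j₂ ≤ x <;> by_cases hc : j₃ ≤ x <;>
    simp [ha, hb, hc, mem_principalUp, funext_iff, Fin.forall_fin_succ]

omit [DecidableEq α] in
/-- The preimage of the pattern up-set #19 under `x ↦ (jᵢ ≤ x)_i` as a lattice slot. [this work] -/
theorem preimage_19 (j₁ j₂ j₃ : α) :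
    (univ.filter fun x : α => (fun i => decide (![j₁, j₂, j₃] i ≤ x)) ∈ (univ : Finset (Fin 3 → Bool))) =
      (univ : Finset α) := by
  ext x
  simp

/-- **Sahi's `C₃` for every slot generated by three join-primes**, every FKG weight, every finite distributive lattice: for any up-set
`U'` of patterns, `0 ≤ latticeE3 μ {x | (jᵢ ≤ x)_i ∈ U'} A B`. [this work] -/
theorem latticeE3_nonneg_of_threePrimes {μ : α → ℝ} (hμ₀ : 0 ≤ μ) (hμ : ∀ a b, μ a * μ b ≤ μ (a ⊓ b) * μ (a ⊔ b))
    {j₁ j₂ j₃ : α} (hj₁ : SupPrime j₁) (hj₂ : SupPrime j₂) (hj₃ : SupPrime j₃) {A B : Finset α}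
    (hA : IsUpperSet (A : Set α)) (hB : IsUpperSet (B : Set α))
    (U' : Finset (Fin 3 → Bool)) (hU : IsUpperSet (U' : Set (Fin 3 → Bool))) :
    0 ≤ latticeE3 μ (univ.filter fun x : α => (fun i => decide (![j₁, j₂, j₃] i ≤ x)) ∈ U') A B := by
  rcases upset_cases U' hU with rfl | rfl | rfl | rfl | rfl | rfl | rfl | rfl | rfl | rfl | rfl | rfl | rfl | rfl |
      rfl | rfl | rfl | rfl | rfl | rfl
  · -- empty slot: the functional vanishes
    have e : (univ.filter fun x : α => (fun i => decide (![j₁, j₂,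
        j₃] i ≤ x)) ∈ (∅ : Finset (Fin 3 → Bool))) = ∅ := by
      ext x; simp
    rw [e]; unfold latticeE3 mass; simp
  · rw [preimage_1]
    rw [SahiC3Cube.latticeE3_comm₁₃]
    exact Literature.Probability.LatticeModels.latticeE3_nonneg_of_principal hμ₀ hμ hB hA (j₁ ⊔ j₂ ⊔ j₃)
  · rw [preimage_2]
    rw [SahiC3Cube.latticeE3_comm₁₃]
    exact Literature.Probability.LatticeModels.latticeE3_nonneg_of_principal hμ₀ hμ hB hA (j₁ ⊔ j₂)
  · rw [preimage_3]
    rw [SahiC3Cube.latticeE3_comm₁₃]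
    exact Literature.Probability.LatticeModels.latticeE3_nonneg_of_principal hμ₀ hμ hB hA (j₁ ⊔ j₃)
  · rw [preimage_4]
    rw [SahiC3Cube.latticeE3_comm₁₃]
    exact Literature.Probability.LatticeModels.latticeE3_nonneg_of_principal hμ₀ hμ hB hA (j₂ ⊔ j₃)
  · rw [preimage_5]
    exact SahiE3FilterRestriction.latticeE3_nonneg_of_sup_supPrime_union hμ₀ hμ j₁ hj₂ hj₃ hA hB
  · rw [preimage_6]
    have h := SahiE3FilterRestriction.latticeE3_nonneg_of_sup_supPrime_union hμ₀ hμ j₂ hj₁ hj₃ hA hB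
    rw [sup_comm j₂ j₁] at h
    exact h
  · rw [preimage_7]
    have h := SahiE3FilterRestriction.latticeE3_nonneg_of_sup_supPrime_union hμ₀ hμ j₃ hj₁ hj₂ hA hB
    rw [sup_comm j₃ j₁, sup_comm j₃ j₂] at h
    exact h
  · rw [preimage_8]
    rw [SahiC3Cube.latticeE3_comm₁₃]
    exact Literature.Probability.LatticeModels.latticeE3_nonneg_of_principal hμ₀ hμ hB hA j₁
  · rw [preimage_9]
    rw [SahiC3Cube.latticeE3_comm₁₃]
    exact Literature.Probability.LatticeModels.latticeE3_nonneg_of_principal hμ₀ hμ hB hA j₂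
  · rw [preimage_10]
    rw [SahiC3Cube.latticeE3_comm₁₃]
    exact Literature.Probability.LatticeModels.latticeE3_nonneg_of_principal hμ₀ hμ hB hA j₃
  · rw [preimage_11]
    exact SahiE3MajSlot.latticeE3_nonneg_of_maj hμ₀ hμ hj₁ hj₂ hj₃ hA hB
  · rw [preimage_12]
    exact SahiE3OrPairSlot.latticeE3_nonneg_of_orPair hμ₀ hμ hj₁ hj₂ hj₃ hA hB
  · rw [preimage_13]
    exact SahiE3OrPairSlot.latticeE3_nonneg_of_orPair hμ₀ hμ hj₂ hj₁ hj₃ hA hB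
  · rw [preimage_14]
    exact SahiE3OrPairSlot.latticeE3_nonneg_of_orPair hμ₀ hμ hj₃ hj₁ hj₂ hA hB
  · rw [preimage_15]
    exact SahiE3TwoPrimeSlot.latticeE3_nonneg_of_supPrime_union hμ₀ hμ hj₁ hj₂ hA hB
  · rw [preimage_16]
    exact SahiE3TwoPrimeSlot.latticeE3_nonneg_of_supPrime_union hμ₀ hμ hj₁ hj₃ hA hB
  · rw [preimage_17]
    exact SahiE3TwoPrimeSlot.latticeE3_nonneg_of_supPrime_union hμ₀ hμ hj₂ hj₃ hA hB
  · rw [preimage_18]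
    exact SahiE3Hit3Slot.latticeE3_nonneg_of_hitThree hμ₀ hμ hj₁ hj₂ hj₃ hA hB
  · rw [preimage_19]
    have h := Literature.Probability.LatticeModels.fkg_upperSet_mass hμ₀ hμ hA hB
    have hZ := Literature.Probability.LatticeModels.mass_nonneg hμ₀ (univ : Finset α)
    have e3 : latticeE3 μ univ A B = mass μ univ * (mass μ univ * mass μ (A ∩ B) - mass μ A * mass μ B) := by
      unfold latticeE3
      try simp only [Finset.univ_inter]
      ring
    rw [e3]
    exact mul_nonneg hZ (sub_nonneg.2 h)

end Summit.CriticalPhenomena.PercolationContinuityZ3.Theorems.SahiE3ThreePrimes
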